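import Literature.NumberTheory.LFunctions.MertensErrorTermsMeanValueRHPiLiMellin
import Literature.NumberTheory.LFunctions.MertensErrorTermsMeanValueRHSufficiencyPiLi
import Literature.NumberTheory.LFunctions.PiLiOscillationFromZero
import HarnessLib

/-!
# RH-EQUIVALENT criterion (Zhao 2025, Thm 1, `i = 2`): `(∀ X > 2, ∫₂^X E₂ > 0) ⟹ RH`, PROVED — nothing here bears on the truth of RH

Topic `Literature/NumberTheory/LFunctions`. L. Zhao, *The Riemann hypothesis and the mean values of the error terms
of Mertens' theorems*, Res. Number Theory 11:62 (2025), arXiv:2411.18903, Theorem 1 (`i = 2`), direction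
(b) ⟹ (a) and the remark "if RH is false … `∫₂^X E_i(x) dx` attains arbitrarily large positive and negative values"
(§3). Here `E₂(x) = Σ_{p ≤ x} 1/p − log log x − B` (the tree's `Zhao2025.E₂`) and, by the source's (2.5)
(`Zhao2025.integral_E₂_eq`), `∫₂^X E₂ = 2T₂(2) − X T₂(X)` with `T₂(y) = ∫_y^∞ (π(t) − li(t)) t⁻² dt`.

**Proof** (the source, §3: "the Mellin transform of `A₂` … Landau's oscillation theorem … leads to a contradiction",
formalized log-free as in the tree's `PiOmega.false_of_nonneg_of_zero` / `PiLi.false_of_eventually_le`, MV §15.1).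
Let `G(x) = η(C₀ − x T₂(max(x,2))) + M ≥ 0` for `x > X₁` (`η = ±1`), and let `ρ₀` be a zero of `ζ` with
`Re ρ₀ > 1/2`; put `b = (1/2 + Re ρ₀)/2`. For `σ > 1` (`MertensErrorTermsMeanValueRHPiLiMellin.lean`)
`F(s) = ∫_1^∞ G x^{-s-1} dx = ηC₀/s + M/s + η (M₂(s) − T₂(2))/(s − 1)` and
`s M₂(s) = Λ̃(s) − s N(s) − li(2) 2^{-s}` with `Λ̃ = D − E` (`PiLi.lamTilde`, `Λ̃' = ζ₁'/ζ₁ + q`) and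
`N = ∫_1^∞ (Π − π) x^{-s-1} dx` holomorphic on `Re s > 1/2`. With the primitive `Λ` of `ζ₁'/ζ₁ + q` on the hole-free
region `{Re s > 1} ∪ {Re s > b/2, |Im s| < 2δ}` (`PiLi.exists_primitive_on_region`) the function
`N_m(s) = Λ(s) − sN(s) − li(2)2^{-s} − sT₂(2)` (`= s(M₂(s) − T₂(2)) = (s − 1)(ηsF(s) − C₀ − ηM)` on `Re s > 1`)
is holomorphic there with `N_m(1) = 0` — THE ONE NEW POINT against `i = 1`: the removable singularity at `s = 1`,
settled by `|F(1 + t)| ≤ ∫_1^∞ |G| x⁻²` (absolute convergence AT `σ = 1`, `Zhao2025.integrableOn_mul_piLiTail_rpow_one`)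
so that `N_m(1 + t) = O(t)` — whence `Φ(s) = (ηC₀ + M + η · dslope N_m 1 (s))/s` continues `F` to
`{Re s > 2} ∪ {Re s > b, |Im s| < 2δ}`; Landau's lemma (`Landau.integrableOn_of_differentiableOn_union_convex`) gives
absolute convergence for `σ > b`, so `T_F(s) = sT₂(2) + (s−1)(ηsF − C₀ − ηM) + sN(s) + li(2)2^{-s}` is holomorphic on
`Re s > b` and equals `Λ̃` on `Re s > 1`; `ζ₁' = (T_F' − q) ζ₁` propagates from `Re s > 2` to `Re s > b ∋ ρ₀`
(`eq_zero_of_deriv_eq_mul`), forcing `ζ₁ ≡ 0`, contradicting `ζ₁(1) = 1`.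

Results: `Zhao2025.false_of_rpow_affine_piLiL_nonneg_of_zero` (core, with the source's power term `κ x^c` of `A₂`),
`Zhao2025.false_of_affine_piLiL_nonneg_of_zero`, `Zhao2025.riemannHypothesis_of_integral_E₂_nonneg`,
`Zhao2025.riemannHypothesis_of_integral_E₂_pos` (Thm 1 (`i = 2`) (b) ⟹ (a) AS PRINTED),
`Zhao2025.riemannHypothesis_iff_eventually_integral_E₂_pos` (with `MertensErrorTermsMeanValueRHSufficiencyPiLi.lean`),
`Zhao2025.frequently_lt_integral_E₂_of_not_RH` / `…_integral_E₂_lt_of_not_RH`, the rate form (3.1)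
`Zhao2025.frequently_rpow_lt_integral_E₂_of_zero` / `…_integral_E₂_lt_neg_rpow_of_zero` (`∫₂^X E₂ ≷ ±X^c` for
arbitrarily large `X`, every `c < Re ρ₀`), and for `i = 3` the positive half of Thm 2's sign changes,
`Zhao2025.frequently_lt_integral_E₃_of_not_RH`. RH-EQUIVALENT criterion; no claim about RH itself is made or used.
Nothing here bears on the truth of RH.

## References

* [Zhao2025MertensMean] L. Zhao, Res. Number Theory 11 (2025) 62, arXiv:2411.18903: Thm 1, §3.
* [MontgomeryVaughan2007] H. L. Montgomery, R. C. Vaughan, *Multiplicative Number Theory I*, CUP 2007, §15.1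
  (Lemma 15.1, proof of Thm 15.2).
-/

noncomputable section

open Complex Filter Topology Set MeasureTheory
open scoped Real Chebyshev

namespace Literature.NumberTheory.LFunctions

namespace Zhao2025

open Landau Nicolas PsiOmega PiOmega ArithmeticFunction

/-! ### Two algebraic identities of the transform -/

/-- Algebra of the transform on `Re s > 1`: from `F = η (C₀/s − (M₂ − T)/(1 − s)) + M/s` (`η = ±1`),
`s (M₂ − T) = (s − 1)(η s F − C₀ − η M)`. [cite: Zhao2025MertensMean, §3 (the transform of A₂)] -/
theorem piLi_transform_algebra {η : ℝ} (hη : η = 1 ∨ η = -1) {s F M₂ T C₀ M : ℂ} (hs0 : s ≠ 0) (hs1 : s ≠ 1)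
    (hF : F = η * (C₀ / s - (M₂ - T) / (1 - s)) + M / s) :
    s * (M₂ - T) = (s - 1) * (η * s * F - C₀ - η * M) := by
  have hs1' : (1 : ℂ) - s ≠ 0 := sub_ne_zero.2 (Ne.symm hs1)
  rcases hη with rfl | rfl
  · rw [hF]; push_cast; field_simp; ring
  · rw [hF]; push_cast; field_simp; ring

/-- Algebra of the continuation: if `N_m = (s − 1)(η s F − C₀ − η M)` (`η = ±1`, `s ≠ 0, 1`) then
`(ηC₀ + M + η N_m/(s − 1))/s = F`. [cite: Zhao2025MertensMean, §3 (the transform of A₂)] -/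
theorem piLi_continuation_algebra {η : ℝ} (hη : η = 1 ∨ η = -1) {s F C₀ M Nm : ℂ} (hs0 : s ≠ 0) (hs1 : s ≠ 1)
    (hNm : Nm = (s - 1) * (η * s * F - C₀ - η * M)) :
    ((η : ℂ) * C₀ + M + η * (Nm / (s - 1))) / s = F := by
  have hs1' : s - 1 ≠ 0 := sub_ne_zero.2 hs1
  rcases hη with rfl | rfl
  · rw [hNm]; push_cast; field_simp; ring
  · rw [hNm]; push_cast; field_simp; ring

/-! ### Landau's theorem for `G = η(C₀ − x T₂(max(x,2))) + M`: the contradiction with a zero off the line -/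

/-- **The contradiction** (the source, §3, `i = 2`: "the Mellin transform of `A₂(x)` … a standard application of
Landau's oscillation theorem … leads to a contradiction"), for the affine modifications needed for "arbitrarily large
positive and negative values" and with the power term of the source's `A₂` for the rate (3.1): if
`G(x) = κ x^c + η(C₀ − x T₂(max(x,2))) + M ≥ 0` for `x > X₁ ≥ 1` (`η = ±1`, `κ, C₀, M` real, `c < 1`,
`T₂(y) = ∫_y^∞ (π − li)/t²`) and `ζ(ρ₀) = 0` with `Re ρ₀ > 1/2`, `Re ρ₀ > c`, then `False` (the extra term transforms
to `κ/(s − c)`, holomorphic on `Re s > c`; the abscissa `b` is taken above `max(1/2, c)`). See the module docstring for the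
log-free rendering (primitive of `ζ₁'/ζ₁ + q` on a hole-free region, removable singularity at `s = 1` from absolute
convergence at `σ = 1`, Landau's lemma, `ζ₁' = aζ₁` propagated to `ρ₀`).
[cite: Zhao2025MertensMean, §3 (proof of Thm 1, necessity, i = 2)] -/
theorem false_of_rpow_affine_piLiL_nonneg_of_zero {X₁ : ℝ} (hX₁ : 1 ≤ X₁) {η : ℝ} (hη : η = 1 ∨ η = -1)
    (κ C₀ M : ℝ) {c : ℝ} (hc1 : c < 1)
    (hpos : ∀ x : ℝ, X₁ < x → 0 ≤ κ * x ^ c +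
      (η * (C₀ - x * ∫ t in Ioi (max x 2), ((Nat.primeCounting ⌊t⌋₊ : ℝ) - logIntegral t) / t ^ 2) + M))
    {ρ₀ : ℂ} (hζ : riemannZeta ρ₀ = 0) (hρ : 1 / 2 < ρ₀.re) (hcρ : c < ρ₀.re) : False := by
  -- the objects
  set T₂ : ℝ := ∫ t in Ioi (2 : ℝ), ((Nat.primeCounting ⌊t⌋₊ : ℝ) - logIntegral t) / t ^ 2 with hT₂def
  set G : ℝ → ℝ := fun x : ℝ => κ * x ^ c +
    (η * (C₀ - x * ∫ t in Ioi (max x 2), ((Nat.primeCounting ⌊t⌋₊ : ℝ) - logIntegral t) / t ^ 2) + M) with hGdef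
  set N : ℂ → ℂ := mellinIoi fun x : ℝ =>
    ∑ n ∈ Finset.Ioc 0 ⌊x⌋₊, Λ n / Real.log n - (Nat.primeCounting ⌊x⌋₊ : ℝ) with hNdef
  set M₂ : ℂ → ℂ := fun s =>
    ∫ t in Ioi (2 : ℝ), (((Nat.primeCounting ⌊t⌋₊ : ℝ) - logIntegral t : ℝ) : ℂ) * (t : ℂ) ^ (-(s + 1)) with hM₂def
  set F : ℂ → ℂ := mellinIoi G with hFdef
  -- the abscissa `b`, `1/2 < b < Re ρ₀ < 1`
  have hρ1 : ρ₀.re < 1 := by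
    by_contra h
    exact riemannZeta_ne_zero_of_one_le_re (not_lt.1 h) hζ
  set m : ℝ := max (1 / 2) c with hmdef
  have hm2 : 1 / 2 ≤ m := le_max_left _ _
  have hmc : c ≤ m := le_max_right _ _
  have hmρ : m < ρ₀.re := max_lt hρ hcρ
  have hm1 : m < 1 := max_lt (by norm_num) hc1
  set b : ℝ := (m + ρ₀.re) / 2 with hbdef
  have hb : m < b := by rw [hbdef]; linarith
  have hbρ : b < ρ₀.re := by rw [hbdef]; linarith
  have hb1 : b < 1 := by rw [hbdef]; linarith
  have hb2 : 1 / 2 < b := lt_of_le_of_lt hm2 hb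
  have hbc : c < b := lt_of_le_of_lt hmc hb
  -- measurability; absolute convergence at `σ₁ = 2` and at `σ = 1`
  have hKm : Measurable fun x : ℝ => κ * x ^ c := (measurable_id.pow_const c).const_mul κ
  have hAm : Measurable fun x : ℝ =>
      η * (C₀ - x * ∫ t in Ioi (max x 2), ((Nat.primeCounting ⌊t⌋₊ : ℝ) - logIntegral t) / t ^ 2) + M :=
    ((measurable_const.sub (measurable_id.mul measurable_piLiTail_max)).const_mul η).add_const M
  have hGm : Measurable G := hKm.add hAm
  have hK2 : IntegrableOn (fun x : ℝ => (κ * x ^ c) * x ^ (-((2 : ℝ) + 1))) (Ioi 1) :=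
    integrableOn_const_mul_rpow κ (integrableOn_rpow_rpow (by linarith))
  have hK1 : IntegrableOn (fun x : ℝ => (κ * x ^ c) * x ^ (-((1 : ℝ) + 1))) (Ioi 1) :=
    integrableOn_const_mul_rpow κ (integrableOn_rpow_rpow hc1)
  have hA1 : IntegrableOn (fun x : ℝ =>
      (η * (C₀ - x * ∫ t in Ioi (max x 2), ((Nat.primeCounting ⌊t⌋₊ : ℝ) - logIntegral t) / t ^ 2) + M) *
        x ^ (-((1 : ℝ) + 1))) (Ioi 1) :=
    integrableOn_add_rpow (g := fun _ : ℝ => M)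
      (integrableOn_const_mul_rpow η (integrableOn_sub_rpow (f := fun _ : ℝ => C₀)
        (integrableOn_const_rpow _ one_pos) integrableOn_mul_piLiTail_rpow_one))
      (integrableOn_const_rpow _ one_pos)
  have hint2 : IntegrableOn (fun x => G x * x ^ (-((2 : ℝ) + 1))) (Ioi 1) :=
    integrableOn_add_rpow hK2 (integrableOn_affine_piLiTail_rpow η C₀ M (by norm_num : (1 : ℝ) < 2))
  have hint1 : IntegrableOn (fun x => G x * x ^ (-((1 : ℝ) + 1))) (Ioi 1) := integrableOn_add_rpow hK1 hA1
  -- `N` is holomorphic on `Re s > 1/2`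
  have hNd : DifferentiableOn ℂ N {s : ℂ | 1 / 2 < s.re} :=
    differentiableOn_mellinIoi_primePowerPi_sub_primeCounting
  -- the transform on `Re s > 1`
  have hF_eq : ∀ s : ℂ, 1 < s.re →
      F s = κ * (1 / (s - c)) + (η * ((C₀ : ℂ) / s - (M₂ s - T₂) / (1 - s)) + M / s) := by
    intro s hs
    have h1 := integrable_ofReal_mul_cpow hKm hK1 hs
    have h2 := integrable_ofReal_mul_cpow hAm hA1 hs
    show mellinIoi G s = _
    rw [mellinIoi_add' h1 h2, mellinIoi_const_mul, mellinIoi_rpow (lt_trans hc1 hs : c < s.re),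
      mellinIoi_affine_piLiTail η C₀ M hs]
  -- `F₀ = F − κ/(s − c)`, the transform of the affine part
  set F₀ : ℂ → ℂ := fun s => F s - κ * (1 / (s - c)) with hF₀def
  have hF₀_eq : ∀ s : ℂ, 1 < s.re → F₀ s = η * ((C₀ : ℂ) / s - (M₂ s - T₂) / (1 - s)) + M / s := by
    intro s hs
    show F s - κ * (1 / (s - c)) = _
    rw [hF_eq s hs]
    ring
  have hM₂_eq : ∀ s : ℂ, 1 < s.re →
      s * M₂ s = PiLi.lamTilde s - s * N s - (logIntegral 2 : ℂ) * (2 : ℂ) ^ (-s) := by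
    intro s hs
    have hs0 : s ≠ 0 := by rintro rfl; rw [Complex.zero_re] at hs; linarith
    have h : M₂ s = LSeries (fun n : ℕ => ((Λ n / Real.log n : ℝ) : ℂ)) s / s - N s -
        mellinIoi (fun x : ℝ => (Ici (2 : ℝ)).indicator (fun y : ℝ => y / Real.log y) x) s / s -
        (logIntegral 2 : ℂ) * (2 : ℂ) ^ (-s) / s := mellinIoi_piLi_eq hs
    unfold PiLi.lamTilde
    rw [h]
    field_simp
    ring
  -- a zero-free strip about the real ray and the primitive `Λ` of `ζ₁'/ζ₁ + q` on the hole-free region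
  obtain ⟨δ, hδ, -, hgap⟩ := ZetaZeroSum.exists_gap_im
  obtain ⟨Lam, hLam, hLamEq⟩ :=
    PiLi.exists_primitive_on_region (a := b / 2) (δ := δ) (by linarith) (by linarith) hδ hgap
  set U₁ : Set ℂ := PiLi.region (b / 2) δ ∩ {s : ℂ | m < s.re} with hU₁def
  have hU₁o : IsOpen U₁ := (PiLi.isOpen_region _ _).inter (isOpen_lt continuous_const Complex.continuous_re)
  have h1U₁ : (1 : ℂ) ∈ U₁ := by
    refine ⟨Or.inr ⟨?_, ?_, ?_⟩, ?_⟩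
    · show b / 2 < (1 : ℂ).re
      rw [Complex.one_re]; linarith
    · show -(2 * δ) < (1 : ℂ).im
      rw [Complex.one_im]; linarith
    · show (1 : ℂ).im < 2 * δ
      rw [Complex.one_im]; linarith
    · show m < (1 : ℂ).re
      rw [Complex.one_re]; exact hm1
  -- `N_m = Λ − sN − li(2)2^{-s} − sT₂(2)`, holomorphic on `U₁`
  set Nm : ℂ → ℂ := fun s => Lam s - s * N s - (logIntegral 2 : ℂ) * (2 : ℂ) ^ (-s) - s * (T₂ : ℂ) with hNmdef
  have hNmd : DifferentiableOn ℂ Nm U₁ := by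
    intro s hs
    have dL : DifferentiableAt ℂ Lam s := (hLam s hs.1).differentiableAt
    have hsm : m < s.re := hs.2
    have dN : DifferentiableAt ℂ N s :=
      hNd.differentiableAt ((isOpen_lt continuous_const Complex.continuous_re).mem_nhds
        (show (1 : ℝ) / 2 < s.re from lt_of_le_of_lt hm2 hsm))
    have dc : DifferentiableAt ℂ (fun z : ℂ => (2 : ℂ) ^ (-z)) s :=
      differentiableAt_id.neg.const_cpow (Or.inl two_ne_zero)
    exact (((dL.sub (differentiableAt_id.mul dN)).sub (dc.const_mul _)).sub
      (differentiableAt_id.mul_const _)).differentiableWithinAt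
  -- on `Re s > 1`: `N_m(s) = s(M₂(s) − T₂(2)) = (s − 1)(ηsF(s) − C₀ − ηM)`
  have hNm_eq : ∀ s : ℂ, 1 < s.re → Nm s = (s - 1) * (η * s * F₀ s - C₀ - η * M) := by
    intro s hs
    have hs0 : s ≠ 0 := by rintro rfl; rw [Complex.zero_re] at hs; linarith
    have hs1 : s ≠ 1 := by rintro rfl; rw [Complex.one_re] at hs; linarith
    have h1 : Nm s = s * (M₂ s - T₂) := by
      have hL : Lam s = PiLi.lamTilde s := hLamEq hs
      show Lam s - s * N s - (logIntegral 2 : ℂ) * (2 : ℂ) ^ (-s) - s * (T₂ : ℂ) = s * (M₂ s - T₂)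
      rw [hL]
      linear_combination -(hM₂_eq s hs)
    rw [h1]
    exact piLi_transform_algebra hη hs0 hs1 (hF₀_eq s hs)
  -- THE NEW POINT: `N_m(1) = 0` (continuity of `N_m` at `1`; `N_m(1+t) = t·O(1)` by absolute convergence at `σ = 1`)
  have hNm1 : Nm 1 = 0 := by
    have hcont : ContinuousAt Nm 1 := ((hNmd 1 h1U₁).differentiableAt (hU₁o.mem_nhds h1U₁)).continuousAt
    have h1t : Tendsto (fun t : ℝ => (1 : ℂ) + t) (𝓝[>] (0 : ℝ)) (𝓝 1) := by
      have hc : Continuous fun t : ℝ => (1 : ℂ) + t := continuous_const.add Complex.continuous_ofReal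
      have h := hc.tendsto 0
      simp only [Complex.ofReal_zero, add_zero] at h
      exact h.mono_left nhdsWithin_le_nhds
    have hlim1 : Tendsto (fun t : ℝ => Nm (1 + t)) (𝓝[>] (0 : ℝ)) (𝓝 (Nm 1)) := hcont.tendsto.comp h1t
    set I : ℝ := (∫ x in Ioi (1 : ℝ), |G x| * x ^ (-((1 : ℝ) + 1))) + |κ| / (1 - c) with hIdef
    have hηn : ‖(η : ℂ)‖ = 1 := by
      rw [Complex.norm_real, Real.norm_eq_abs]
      rcases hη with rfl | rfl <;> norm_num
    have hbd : ∀ᶠ t : ℝ in 𝓝[>] (0 : ℝ), ‖Nm (1 + t)‖ ≤ (2 * I + |C₀| + |M|) * t := by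
      filter_upwards [Ioc_mem_nhdsGT (zero_lt_one' ℝ)] with t ht
      have ht0 : 0 < t := ht.1
      have ht1 : t ≤ 1 := ht.2
      set s : ℂ := 1 + (t : ℂ) with hsdef
      have hsre : s.re = 1 + t := by simp [hsdef]
      have hs : 1 < s.re := by rw [hsre]; linarith
      have hFs' : ‖F s‖ ≤ ∫ x in Ioi (1 : ℝ), |G x| * x ^ (-((1 : ℝ) + 1)) :=
        norm_mellinIoi_le (by rw [hsre]; linarith) hint1
      have hκs : ‖(κ : ℂ) * (1 / (s - c))‖ ≤ |κ| / (1 - c) := by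
        have hre : (s - (c : ℂ)).re = 1 + t - c := by simp [hsdef]
        have hn : 1 - c ≤ ‖s - (c : ℂ)‖ := by
          have h := abs_re_le_norm (s - (c : ℂ))
          rw [hre, abs_of_pos (by linarith)] at h
          linarith
        rw [norm_mul, Complex.norm_real, Real.norm_eq_abs, norm_div, norm_one, div_eq_mul_one_div |κ| (1 - c)]
        exact mul_le_mul_of_nonneg_left (one_div_le_one_div_of_le (by linarith) hn) (abs_nonneg κ)
      have hFs : ‖F₀ s‖ ≤ I := by
        have h := norm_sub_le (F s) ((κ : ℂ) * (1 / (s - c)))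
        show ‖F s - κ * (1 / (s - c))‖ ≤ I
        rw [hIdef]
        linarith
      have hs1n : ‖s - 1‖ = t := by
        rw [hsdef, add_sub_cancel_left, Complex.norm_real, Real.norm_eq_abs, abs_of_pos ht0]
      have hsn : ‖s‖ ≤ 2 := by
        calc ‖s‖ = ‖(1 : ℂ) + t‖ := rfl
          _ ≤ ‖(1 : ℂ)‖ + ‖(t : ℂ)‖ := norm_add_le _ _
          _ = 1 + t := by rw [norm_one, Complex.norm_real, Real.norm_eq_abs, abs_of_pos ht0]
          _ ≤ 2 := by linarith
      have e1 : ‖(η : ℂ) * s * F₀ s‖ ≤ 2 * I := by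
        rw [norm_mul, norm_mul, hηn, one_mul]
        exact mul_le_mul hsn hFs (norm_nonneg _) zero_le_two
      have e2 : ‖(C₀ : ℂ)‖ = |C₀| := by rw [Complex.norm_real, Real.norm_eq_abs]
      have e3 : ‖(η : ℂ) * M‖ = |M| := by rw [norm_mul, hηn, one_mul, Complex.norm_real, Real.norm_eq_abs]
      have h2 : ‖(η : ℂ) * s * F₀ s - C₀ - η * M‖ ≤ 2 * I + |C₀| + |M| := by
        have i1 := norm_sub_le ((η : ℂ) * s * F₀ s - C₀) ((η : ℂ) * M)
        have i2 := norm_sub_le ((η : ℂ) * s * F₀ s) (C₀ : ℂ)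
        linarith
      rw [hNm_eq s hs, norm_mul, hs1n]
      calc t * ‖(η : ℂ) * s * F₀ s - C₀ - η * M‖ ≤ t * (2 * I + |C₀| + |M|) :=
            mul_le_mul_of_nonneg_left h2 ht0.le
        _ = (2 * I + |C₀| + |M|) * t := mul_comm _ _
    have hlim0 : Tendsto (fun t : ℝ => Nm (1 + t)) (𝓝[>] (0 : ℝ)) (𝓝 0) := by
      refine squeeze_zero_norm' hbd ?_
      have h : Tendsto (fun t : ℝ => (2 * I + |C₀| + |M|) * t) (𝓝 (0 : ℝ)) (𝓝 ((2 * I + |C₀| + |M|) * 0)) :=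
        (continuous_const.mul continuous_id).tendsto 0
      rw [mul_zero] at h
      exact h.mono_left nhdsWithin_le_nhds
    exact tendsto_nhds_unique hlim1 hlim0
  -- the continuation `Φ(s) = (ηC₀ + M + η · dslope N_m 1 s)/s`, holomorphic on `U₁ ∋ 1`
  have hdNm : DifferentiableOn ℂ (dslope Nm 1) U₁ := (differentiableOn_dslope (hU₁o.mem_nhds h1U₁)).2 hNmd
  set Φ : ℂ → ℂ := fun s => κ * (1 / (s - c)) + ((η : ℂ) * C₀ + M + η * dslope Nm 1 s) / s with hΦdef
  have hΦd : DifferentiableOn ℂ Φ U₁ := by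
    intro s hs
    have hsm : m < s.re := hs.2
    have hs0 : s ≠ 0 := by
      rintro rfl
      rw [Complex.zero_re] at hsm
      linarith
    have hsc : s - (c : ℂ) ≠ 0 := by
      intro h
      have := congrArg Complex.re h
      simp at this
      linarith
    have d1 : DifferentiableAt ℂ (fun z : ℂ => z - (c : ℂ)) s := differentiableAt_id.sub_const _
    have d0 : DifferentiableAt ℂ (fun z : ℂ => (κ : ℂ) * (1 / (z - c))) s :=
      ((differentiableAt_const (1 : ℂ)).fun_div d1 hsc).const_mul (κ : ℂ)
    have d2 : DifferentiableWithinAt ℂ (fun z : ℂ => ((η : ℂ) * C₀ + M + η * dslope Nm 1 z) / z) U₁ s :=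
      (((hdNm s hs).const_mul (η : ℂ)).const_add _).fun_div differentiableWithinAt_id hs0
    exact d0.differentiableWithinAt.add d2
  have hΦ_eq : ∀ s : ℂ, 1 < s.re → Φ s = F s := by
    intro s hs
    have hs0 : s ≠ 0 := by rintro rfl; rw [Complex.zero_re] at hs; linarith
    have hs1 : s ≠ 1 := by rintro rfl; rw [Complex.one_re] at hs; linarith
    have h0 : ((η : ℂ) * C₀ + M + η * dslope Nm 1 s) / s = F₀ s := by
      rw [dslope_of_ne _ hs1, slope_def_field, hNm1, sub_zero]
      exact piLi_continuation_algebra hη hs0 hs1 (hNm_eq s hs)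
    show κ * (1 / (s - c)) + ((η : ℂ) * C₀ + M + η * dslope Nm 1 s) / s = F s
    rw [h0]
    show κ * (1 / (s - c)) + (F s - κ * (1 / (s - c))) = F s
    ring
  -- Landau's lemma on `{Re s > 2} ∪ W₀`, `W₀ = {Re s > b, |Im s| < 2δ} ⊆ U₁`
  set W₀ : Set ℂ := PiLi.strip b δ with hW₀
  have hW₀r : ∀ σ' : ℝ, b < σ' → σ' ≤ 2 + 1 → (σ' : ℂ) ∈ W₀ := by
    intro σ' h1 _
    refine ⟨by simpa using h1, ?_, ?_⟩
    · show -(2 * δ) < ((σ' : ℝ) : ℂ).im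
      rw [ofReal_im]; linarith
    · show ((σ' : ℝ) : ℂ).im < 2 * δ
      rw [ofReal_im]; linarith
  have hsub : {s : ℂ | 2 < s.re} ∪ W₀ ⊆ U₁ := by
    rintro s (hs | hs)
    · have hs' : 2 < s.re := hs
      exact ⟨Or.inl (show (1 : ℝ) < s.re by linarith), show m < s.re by linarith⟩
    · exact ⟨Or.inr ⟨by linarith [hs.1], hs.2.1, hs.2.2⟩, show m < s.re by linarith [hs.1]⟩
  have hΦd' : DifferentiableOn ℂ Φ ({s : ℂ | 2 < s.re} ∪ W₀) := hΦd.mono hsub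
  have hagree : EqOn Φ (mellinIoi G) {s : ℂ | 2 < s.re} := by
    intro s hs
    have hs' : 2 < s.re := hs
    exact hΦ_eq s (by linarith)
  have hLandau : ∀ σ' : ℝ, b < σ' → IntegrableOn (fun x => G x * x ^ (-(σ' + 1))) (Ioi 1) :=
    fun σ' hσ' => integrableOn_of_differentiableOn_union_convex hGm hint2 hX₁ hpos
      (by linarith : b < 2) (PiLi.isOpen_strip b δ) (PiLi.convex_strip b δ) hW₀r hΦd' hagree hσ'
  -- the transform is holomorphic on `U = {Re s > b}`; `T_F` and the coefficient `a = T_F' − q`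
  set U : Set ℂ := {s : ℂ | b < s.re} with hU
  have hUo : IsOpen U := isOpen_lt continuous_const Complex.continuous_re
  have hFd : DifferentiableOn ℂ F U := differentiableOn_mellinIoi_of_forall hGm hLandau
  set TF : ℂ → ℂ := fun s => s * (T₂ : ℂ) + (s - 1) * (η * s * F₀ s - C₀ - η * M) + s * N s +
    (logIntegral 2 : ℂ) * (2 : ℂ) ^ (-s) with hTFdef
  have hTFd : DifferentiableOn ℂ TF U := by
    intro s hs
    have hs' : b < s.re := hs
    have hsc : s - (c : ℂ) ≠ 0 := by
      intro h
      have := congrArg Complex.re h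
      simp at this
      linarith
    have dF : DifferentiableAt ℂ F s := (hFd s hs).differentiableAt (hUo.mem_nhds hs)
    have d1' : DifferentiableAt ℂ (fun z : ℂ => z - (c : ℂ)) s := differentiableAt_id.sub_const _
    have d2' : DifferentiableAt ℂ (fun z : ℂ => (κ : ℂ) * (1 / (z - c))) s :=
      ((differentiableAt_const (1 : ℂ)).fun_div d1' hsc).const_mul (κ : ℂ)
    have dF₀ : DifferentiableAt ℂ F₀ s := dF.fun_sub d2'
    have dN : DifferentiableAt ℂ N s := hNd.differentiableAt
      ((isOpen_lt continuous_const Complex.continuous_re).mem_nhds (show (1 : ℝ) / 2 < s.re by linarith))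
    have dc : DifferentiableAt ℂ (fun z : ℂ => (2 : ℂ) ^ (-z)) s :=
      differentiableAt_id.neg.const_cpow (Or.inl two_ne_zero)
    have d1 : DifferentiableAt ℂ (fun z : ℂ => (η : ℂ) * z * F₀ z - C₀ - η * M) s :=
      ((((differentiableAt_const _).mul differentiableAt_id).mul dF₀).sub_const _).sub_const _
    exact ((((differentiableAt_id.mul_const _).add ((differentiableAt_id.sub_const _).mul d1)).add
      (differentiableAt_id.mul dN)).add (dc.const_mul _)).differentiableWithinAt
  have hTF_eq : ∀ s : ℂ, 1 < s.re → TF s = PiLi.lamTilde s := by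
    intro s hs
    have h1 := hNm_eq s hs
    have hL : Lam s = PiLi.lamTilde s := hLamEq hs
    show s * (T₂ : ℂ) + (s - 1) * (η * s * F₀ s - C₀ - η * M) + s * N s + (logIntegral 2 : ℂ) * (2 : ℂ) ^ (-s) =
      PiLi.lamTilde s
    rw [← h1, ← hL]
    show s * (T₂ : ℂ) + (Lam s - s * N s - (logIntegral 2 : ℂ) * (2 : ℂ) ^ (-s) - s * (T₂ : ℂ)) + s * N s +
      (logIntegral 2 : ℂ) * (2 : ℂ) ^ (-s) = Lam s
    ring
  set a : ℂ → ℂ := fun s => deriv TF s - PiLi.qFn s with ha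
  have had : DifferentiableOn ℂ a U :=
    ((hTFd.analyticOnNhd hUo).deriv.differentiableOn).sub PiLi.differentiable_qFn.differentiableOn
  -- `ζ₁' = a ζ₁` on `Re s > 2`, hence on `U`
  have hODE₂ : ∀ s : ℂ, 2 < s.re → deriv riemannZeta₁ s = a s * riemannZeta₁ s := by
    intro s hs
    have hs1 : s ≠ 1 := by rintro rfl; rw [Complex.one_re] at hs; linarith
    have hζ₁ : riemannZeta₁ s ≠ 0 := by
      rw [Ne, riemannZeta₁_eq_zero_iff hs1]
      exact riemannZeta_ne_zero_of_one_lt_re (by linarith)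
    have hev : TF =ᶠ[𝓝 s] PiLi.lamTilde := by
      filter_upwards [(isOpen_re_gt 1).mem_nhds (show s ∈ {z : ℂ | (1 : ℝ) < z.re} by
        show (1 : ℝ) < s.re; linarith)] with z hz
      exact hTF_eq z hz
    have hderiv : deriv TF s = logDeriv riemannZeta₁ s + PiLi.qFn s := by
      rw [hev.deriv_eq]
      exact (PiLi.hasDerivAt_lamTilde (by linarith : 1 < s.re)).deriv
    have haL : a s = logDeriv riemannZeta₁ s := by
      show deriv TF s - PiLi.qFn s = _
      rw [hderiv]; ring
    rw [haL, logDeriv_apply, div_mul_cancel₀ _ hζ₁]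
  have hODE : EqOn (deriv riemannZeta₁) (fun s => a s * riemannZeta₁ s) U := by
    set D : ℂ → ℂ := fun s => deriv riemannZeta₁ s - a s * riemannZeta₁ s with hD
    have hDd : DifferentiableOn ℂ D U := by
      intro s hs
      exact ((differentiable_riemannZeta₁.analyticAt s).deriv.differentiableAt.differentiableWithinAt).sub
        ((had s hs).mul (differentiable_riemannZeta₁ s).differentiableWithinAt)
    have hDa : AnalyticOnNhd ℂ D U := hDd.analyticOnNhd hUo
    have hUpre : IsPreconnected U := (convex_halfSpace_re_gt b).isPreconnected
    have h3U : (3 : ℂ) ∈ U := by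
      show b < (3 : ℂ).re
      norm_num; linarith
    have hev : D =ᶠ[𝓝 (3 : ℂ)] 0 := by
      have h3 : (3 : ℂ) ∈ {s : ℂ | (2 : ℝ) < s.re} := by
        show (2 : ℝ) < (3 : ℂ).re
        norm_num
      filter_upwards [(isOpen_lt continuous_const Complex.continuous_re).mem_nhds h3] with s hs
      simp only [hD, Pi.zero_apply, hODE₂ s hs, sub_self]
    have hz := hDa.eqOn_zero_of_preconnected_of_eventuallyEq_zero hUpre h3U hev
    intro s hs
    have := hz hs
    simp only [hD, Pi.zero_apply, sub_eq_zero] at this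
    exact this
  -- the zero `ρ₀ ∈ U` propagates: `ζ₁ ≡ 0`, contradicting `ζ₁(1) = 1`
  have hρne : ρ₀ ≠ 1 := by
    rintro rfl
    exact riemannZeta_one_ne_zero hζ
  have hζ₁ : riemannZeta₁ ρ₀ = 0 := (riemannZeta₁_eq_zero_iff hρne).2 hζ
  have hzero := eq_zero_of_deriv_eq_mul differentiable_riemannZeta₁ hUo had hODE
    (show ρ₀ ∈ U from hbρ) hζ₁
  have h1 := congrFun hzero 1
  rw [riemannZeta₁_one, Pi.zero_apply] at h1
  exact one_ne_zero h1

/-- **The contradiction, affine form** (`κ = 0`): if `η(C₀ − x T₂(max(x,2))) + M ≥ 0` for `x > X₁ ≥ 1` (`η = ±1`) and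
`ζ(ρ₀) = 0` with `Re ρ₀ > 1/2`, then `False` — what "arbitrarily large positive and negative values" requires.
[cite: Zhao2025MertensMean, §3 (proof of Thm 1, necessity, i = 2)] -/
theorem false_of_affine_piLiL_nonneg_of_zero {X₁ : ℝ} (hX₁ : 1 ≤ X₁) {η : ℝ} (hη : η = 1 ∨ η = -1) (C₀ M : ℝ)
    (hpos : ∀ x : ℝ, X₁ < x →
      0 ≤ η * (C₀ - x * ∫ t in Ioi (max x 2), ((Nat.primeCounting ⌊t⌋₊ : ℝ) - logIntegral t) / t ^ 2) + M)
    {ρ₀ : ℂ} (hζ : riemannZeta ρ₀ = 0) (hρ : 1 / 2 < ρ₀.re) : False :=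
  false_of_rpow_affine_piLiL_nonneg_of_zero hX₁ hη 0 C₀ M (c := 0) zero_lt_one
    (fun x hx => by rw [zero_mul, zero_add]; exact hpos x hx) hζ hρ (lt_trans one_half_pos hρ)

/-- **The contradiction for the integrated error term itself** (`η = 1`, `M = 0`, `C₀ = 2T₂(2)`): if
`2T₂(2) − x T₂(max(x,2)) ≥ 0` for `x > X₁ ≥ 1` and `ζ(ρ₀) = 0` with `Re ρ₀ > 1/2`, then `False`.
[cite: Zhao2025MertensMean, §3 (proof of Thm 1, necessity, i = 2)] -/
theorem false_of_piLiL_nonneg_of_zero {X₁ : ℝ} (hX₁ : 1 ≤ X₁)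
    (hpos : ∀ x : ℝ, X₁ < x →
      0 ≤ 2 * (∫ t in Ioi (2 : ℝ), ((Nat.primeCounting ⌊t⌋₊ : ℝ) - logIntegral t) / t ^ 2) -
        x * ∫ t in Ioi (max x 2), ((Nat.primeCounting ⌊t⌋₊ : ℝ) - logIntegral t) / t ^ 2)
    {ρ₀ : ℂ} (hζ : riemannZeta ρ₀ = 0) (hρ : 1 / 2 < ρ₀.re) : False :=
  false_of_affine_piLiL_nonneg_of_zero hX₁ (η := 1) (Or.inl rfl) _ 0
    (fun x hx => by rw [one_mul, add_zero]; exact hpos x hx) hζ hρ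

/-! ### Theorem 1 (`i = 2`), (b) ⟹ (a) -/

/-- **Zhao 2025, Theorem 1 (`i = 2`), necessity, PROVED in eventual form**: if `∫₂^X E₂(x) dx ≥ 0` for all
`X > X₁`, then the Riemann Hypothesis holds (a zero `ρ₀` with `Re ρ₀ > 1/2` is excluded by
`false_of_piLiL_nonneg_of_zero` since `∫₂^X E₂ = 2T₂(2) − X T₂(X)` by (2.5), `Zhao2025.integral_E₂_eq`; the symmetry
of the zeros, `quasiRiemannHypothesis_one_half_iff_holds`, does the rest). RH-EQUIVALENT criterion, one direction.
[cite: Zhao2025MertensMean, Thm 1 (i = 2), (b) ⟹ (a); §3] -/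
theorem riemannHypothesis_of_integral_E₂_nonneg {X₁ : ℝ}
    (h : ∀ X : ℝ, X₁ < X → 0 ≤ ∫ x in (2 : ℝ)..X, E₂ x) : RiemannHypothesis := by
  refine quasiRiemannHypothesis_one_half_iff_holds.1 fun ρ₀ hζ hρ _ => ?_
  refine false_of_piLiL_nonneg_of_zero (X₁ := max X₁ 2) (le_trans one_le_two (le_max_right _ _))
    (fun x hx => ?_) hζ hρ
  have hx2 : 2 ≤ x := (le_max_right _ _).trans hx.le
  rw [max_eq_left hx2, ← integral_E₂_eq hx2]
  exact h x (lt_of_le_of_lt (le_max_left _ _) hx)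

/-- **Zhao 2025, Theorem 1 (`i = 2`), (b) ⟹ (a) AS PRINTED**: `(∀ X > 2, ∫₂^X E₂(x) dx > 0) ⟹ RH` — the `←`
direction of clause 2 of the named fact `Zhao2025MertensMean_thm1`, now a theorem.
[cite: Zhao2025MertensMean, Thm 1 (i = 2), (b) ⟹ (a)] -/
theorem riemannHypothesis_of_integral_E₂_pos
    (h : ∀ X : ℝ, 2 < X → 0 < ∫ x in (2 : ℝ)..X, E₂ x) : RiemannHypothesis :=
  riemannHypothesis_of_integral_E₂_nonneg (X₁ := 2) fun X hX => (h X hX).le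

/-- **Zhao 2025, Theorem 1 (`i = 2`) in the "sufficiently large `X`" reading, PROVED**:
`RH ⟺ ∃ X₀, ∀ X > X₀, ∫₂^X E₂(x) dx > 0` (`⟸` is `riemannHypothesis_of_integral_E₂_nonneg`, Landau's theorem;
`⟹` is `eventually_integral_E₂_pos_of_RH`, `MertensErrorTermsMeanValueRHSufficiencyPiLi.lean`). The printed (b) has
`X > 2`; its finite range `2 < X ≤ X₀` is the source's numerical input and is not formalized. RH-EQUIVALENT criterion.
[cite: Zhao2025MertensMean, Thm 1 (i = 2)] -/
theorem riemannHypothesis_iff_eventually_integral_E₂_pos :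
    RiemannHypothesis ↔ ∃ X₀ : ℝ, ∀ X : ℝ, X₀ < X → 0 < ∫ x in (2 : ℝ)..X, E₂ x := by
  constructor
  · intro hRH
    obtain ⟨X₀, hX₀⟩ := (eventually_integral_E₂_pos_of_RH hRH).exists_forall_of_atTop
    exact ⟨X₀, fun X hX => hX₀ X hX.le⟩
  · rintro ⟨X₀, h⟩
    exact riemannHypothesis_of_integral_E₂_nonneg (X₁ := X₀) fun X hX => (h X hX).le

/-! ### If RH fails: arbitrarily large positive and negative values -/

/-- **If RH is false, `∫₂^X E₂(x) dx` takes arbitrarily large positive values** — the source's "if RH is false …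
`∫₂^X E_i(x) dx` attains arbitrarily large positive and negative values" for `i = 2`, without a rate (Landau applied to
`M − ∫₂^x E₂ ≥ 0`). [cite: Zhao2025MertensMean, §3 (i = 2), weak form] -/
theorem frequently_lt_integral_E₂_of_not_RH (hRH : ¬ RiemannHypothesis) (M : ℝ) :
    ∃ᶠ X : ℝ in atTop, M < ∫ x in (2 : ℝ)..X, E₂ x := by
  obtain ⟨ρ₀, hζ, hρ⟩ := exists_zero_of_not_RH hRH
  by_contra hnot
  rw [Filter.not_frequently] at hnot
  obtain ⟨X, hX⟩ := Filter.eventually_atTop.1 hnot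
  refine false_of_affine_piLiL_nonneg_of_zero (X₁ := max X 2) (le_trans one_le_two (le_max_right _ _))
    (η := -1) (Or.inr rfl) (2 * ∫ t in Ioi (2 : ℝ), ((Nat.primeCounting ⌊t⌋₊ : ℝ) - logIntegral t) / t ^ 2) M
    (fun x hx => ?_) hζ hρ
  have hx2 : 2 ≤ x := (le_max_right _ _).trans hx.le
  have := hX x ((le_max_left _ _).trans hx.le)
  rw [not_lt, integral_E₂_eq hx2] at this
  rw [max_eq_left hx2]
  linarith

/-- **If RH is false, `∫₂^X E₂(x) dx` takes arbitrarily large negative values** (Landau applied to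
`∫₂^x E₂ − M ≥ 0`). [cite: Zhao2025MertensMean, §3 (i = 2), weak form] -/
theorem frequently_integral_E₂_lt_of_not_RH (hRH : ¬ RiemannHypothesis) (M : ℝ) :
    ∃ᶠ X : ℝ in atTop, ∫ x in (2 : ℝ)..X, E₂ x < M := by
  obtain ⟨ρ₀, hζ, hρ⟩ := exists_zero_of_not_RH hRH
  by_contra hnot
  rw [Filter.not_frequently] at hnot
  obtain ⟨X, hX⟩ := Filter.eventually_atTop.1 hnot
  refine false_of_affine_piLiL_nonneg_of_zero (X₁ := max X 2) (le_trans one_le_two (le_max_right _ _))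
    (η := 1) (Or.inl rfl) (2 * ∫ t in Ioi (2 : ℝ), ((Nat.primeCounting ⌊t⌋₊ : ℝ) - logIntegral t) / t ^ 2) (-M)
    (fun x hx => ?_) hζ hρ
  have hx2 : 2 ≤ x := (le_max_right _ _).trans hx.le
  have := hX x ((le_max_left _ _).trans hx.le)
  rw [not_lt, integral_E₂_eq hx2] at this
  rw [max_eq_left hx2]
  linarith

/-! ### (3.1) for `i = 2`, with rate: `∫₂^X E₂ = Ω±(X^c)` for every `c < Re ρ₀` at a zero `ρ₀` off the line -/

/-- **(3.1), `i = 2`, `Ω₊` with rate**: if `ζ(ρ₀) = 0` with `Re ρ₀ > 1/2` and `c < Re ρ₀`, then `∫₂^X E₂(x) dx > X^c`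
for arbitrarily large `X` (Landau applied to `X^c − ∫₂^X E₂ ≥ 0`, the source's `A₂` with `X^{Θ−1−ε}`; the printed
`Ω±(X^{Θ−ε})`, `Θ = sup Re ρ`, is this statement zero by zero). [cite: Zhao2025MertensMean, §3 (3.1), i = 2] -/
theorem frequently_rpow_lt_integral_E₂_of_zero {ρ₀ : ℂ} (hζ : riemannZeta ρ₀ = 0) (hρ : 1 / 2 < ρ₀.re)
    {c : ℝ} (hc : c < ρ₀.re) : ∃ᶠ X : ℝ in atTop, X ^ c < ∫ x in (2 : ℝ)..X, E₂ x := by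
  have hρ1 : ρ₀.re < 1 := by
    by_contra h
    exact riemannZeta_ne_zero_of_one_le_re (not_lt.1 h) hζ
  by_contra hnot
  rw [Filter.not_frequently] at hnot
  obtain ⟨X, hX⟩ := Filter.eventually_atTop.1 hnot
  refine false_of_rpow_affine_piLiL_nonneg_of_zero (X₁ := max X 2) (le_trans one_le_two (le_max_right _ _))
    (η := -1) (Or.inr rfl) 1 (2 * ∫ t in Ioi (2 : ℝ), ((Nat.primeCounting ⌊t⌋₊ : ℝ) - logIntegral t) / t ^ 2) 0
    (lt_trans hc hρ1) (fun x hx => ?_) hζ hρ hc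
  have hx2 : 2 ≤ x := (le_max_right _ _).trans hx.le
  have := hX x ((le_max_left _ _).trans hx.le)
  rw [not_lt, integral_E₂_eq hx2] at this
  rw [max_eq_left hx2]
  linarith

/-- **(3.1), `i = 2`, `Ω₋` with rate**: if `ζ(ρ₀) = 0` with `Re ρ₀ > 1/2` and `c < Re ρ₀`, then `∫₂^X E₂(x) dx < −X^c`
for arbitrarily large `X` (Landau applied to `X^c + ∫₂^X E₂ ≥ 0`). [cite: Zhao2025MertensMean, §3 (3.1), i = 2] -/
theorem frequently_integral_E₂_lt_neg_rpow_of_zero {ρ₀ : ℂ} (hζ : riemannZeta ρ₀ = 0) (hρ : 1 / 2 < ρ₀.re)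
    {c : ℝ} (hc : c < ρ₀.re) : ∃ᶠ X : ℝ in atTop, ∫ x in (2 : ℝ)..X, E₂ x < -X ^ c := by
  have hρ1 : ρ₀.re < 1 := by
    by_contra h
    exact riemannZeta_ne_zero_of_one_le_re (not_lt.1 h) hζ
  by_contra hnot
  rw [Filter.not_frequently] at hnot
  obtain ⟨X, hX⟩ := Filter.eventually_atTop.1 hnot
  refine false_of_rpow_affine_piLiL_nonneg_of_zero (X₁ := max X 2) (le_trans one_le_two (le_max_right _ _))
    (η := 1) (Or.inl rfl) 1 (2 * ∫ t in Ioi (2 : ℝ), ((Nat.primeCounting ⌊t⌋₊ : ℝ) - logIntegral t) / t ^ 2) 0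
    (lt_trans hc hρ1) (fun x hx => ?_) hζ hρ hc
  have hx2 : 2 ≤ x := (le_max_right _ _).trans hx.le
  have := hX x ((le_max_left _ _).trans hx.le)
  rw [not_lt, integral_E₂_eq hx2] at this
  rw [max_eq_left hx2]
  linarith

/-! ### `i = 3`: arbitrarily large positive values of `∫₂^X E₃` if RH fails -/

/-- **If RH is false, `∫₂^X E₃(x) dx` takes arbitrarily large positive values** — the positive half of "changes
sign infinitely often" in Thm 2 (there under `1/2 < Θ < 1`), here from ANY failure of RH: `∫₂^X E₃ ≥ e^γ(∫₂^X E₂ −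
2 log(X/2))` (`Zhao2025.integral_E₃_ge`, from `E₃ = e^γ(exp(E₂ − δ) − 1) ≥ e^γ(E₂ − 2/x)`) and `∫₂^X E₂ > X^{1/2}` for
arbitrarily large `X` (`frequently_rpow_lt_integral_E₂_of_zero`). The negative half needs the source's second-moment
Lemma 8 (`∫₂^X E₂² ≪ X^{2Θ−1}`) and is not formalized. [cite: Zhao2025MertensMean, Thm 2 and §4, positive half, weak form] -/
theorem frequently_lt_integral_E₃_of_not_RH (hRH : ¬ RiemannHypothesis) (M : ℝ) :
    ∃ᶠ X : ℝ in atTop, M < ∫ x in (2 : ℝ)..X, E₃ x := by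
  obtain ⟨ρ₀, hζ, hρ⟩ := exists_zero_of_not_RH hRH
  have h1 := frequently_rpow_lt_integral_E₂_of_zero hζ hρ (c := 1 / 2) hρ
  -- `X^{1/2} − 2 log X → +∞`
  have hlim : Tendsto (fun X : ℝ => X ^ (1 / 2 : ℝ) - 2 * Real.log X) atTop atTop := by
    have h0 : Tendsto (fun X : ℝ => Real.log X / X ^ (1 / 2 : ℝ)) atTop (𝓝 0) :=
      (isLittleO_log_rpow_atTop (by norm_num : (0 : ℝ) < 1 / 2)).tendsto_div_nhds_zero
    have h2 : Tendsto (fun X : ℝ => 1 - 2 * (Real.log X / X ^ (1 / 2 : ℝ))) atTop (𝓝 (1 - 2 * 0)) :=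
      tendsto_const_nhds.sub (h0.const_mul 2)
    rw [mul_zero, sub_zero] at h2
    have h3 := (tendsto_rpow_atTop (by norm_num : (0 : ℝ) < 1 / 2)).atTop_mul_pos one_pos h2
    refine h3.congr' ?_
    filter_upwards [eventually_gt_atTop 0] with X hX
    have hX' : X ^ (1 / 2 : ℝ) ≠ 0 := (Real.rpow_pos_of_pos hX _).ne'
    have e : X ^ (1 / 2 : ℝ) * (2 * (Real.log X / X ^ (1 / 2 : ℝ))) = 2 * Real.log X := by
      field_simp
    rw [mul_sub, mul_one, e]
  have hγ : 0 < Real.exp Real.eulerMascheroniConstant := Real.exp_pos _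
  have h2 : ∀ᶠ X : ℝ in atTop,
      M < Real.exp Real.eulerMascheroniConstant * (X ^ (1 / 2 : ℝ) - 2 * Real.log (X / 2)) ∧ 2 ≤ X := by
    have ht : Tendsto (fun X : ℝ => Real.exp Real.eulerMascheroniConstant * (X ^ (1 / 2 : ℝ) - 2 * Real.log X))
        atTop atTop := hlim.const_mul_atTop hγ
    filter_upwards [ht.eventually_gt_atTop M, eventually_ge_atTop 2] with X hM hX2
    refine ⟨lt_of_lt_of_le hM (mul_le_mul_of_nonneg_left ?_ hγ.le), hX2⟩
    have : Real.log (X / 2) ≤ Real.log X := Real.log_le_log (by linarith) (by linarith)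
    linarith
  refine (h1.and_eventually h2).mono ?_
  rintro X ⟨hX, hM, hX2⟩
  have h3 := integral_E₃_ge hX2
  have p1 := mul_lt_mul_of_pos_left hX hγ
  linarith

/-- **Thm 2, clause 2, positive half, PROVED from `¬RH` alone**: if RH fails then `∫₂^X E₃(x) dx > 0` for arbitrarily
large `X` — the first conjunct of clause 2 of the named fact `Zhao2025MertensMean_thm2`, with its zero-free-strip
hypothesis (`Θ < 1`) not needed for this half. [cite: Zhao2025MertensMean, Thm 2 (1/2 < Θ < 1), positive half] -/
theorem thm2_clause2_pos_of_not_RH (hRH : ¬ RiemannHypothesis)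
    (_hstrip : ∃ δ : ℝ, 0 < δ ∧ ∀ ρ : ℂ, riemannZeta ρ = 0 → 0 < ρ.re → ρ.re < 1 → ρ.re ≤ 1 - δ) (X₀ : ℝ) :
    ∃ X : ℝ, X₀ ≤ X ∧ 0 < ∫ x in (2 : ℝ)..X, E₃ x :=
  Filter.frequently_atTop.1 (frequently_lt_integral_E₃_of_not_RH hRH 0) X₀

/-- **If RH is false, `∫₂^X E₂(x) dx > 0` and `< 0` for arbitrarily large `X`** (both sign patterns beyond every `X₀`),
the `i = 2` companion of the previous statement. [cite: Zhao2025MertensMean, §3 (i = 2)] -/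
theorem integral_E₂_changes_sign_of_not_RH (hRH : ¬ RiemannHypothesis) (X₀ : ℝ) :
    (∃ X : ℝ, X₀ ≤ X ∧ 0 < ∫ x in (2 : ℝ)..X, E₂ x) ∧ (∃ X : ℝ, X₀ ≤ X ∧ ∫ x in (2 : ℝ)..X, E₂ x < 0) :=
  ⟨Filter.frequently_atTop.1 (frequently_lt_integral_E₂_of_not_RH hRH 0) X₀,
    Filter.frequently_atTop.1 (frequently_integral_E₂_lt_of_not_RH hRH 0) X₀⟩

end Zhao2025

/-! ### Theorem 1, both clauses, in the kernel -/

/-- **Zhao 2025, Theorem 1, (b) ⟹ (a) for both `i = 1, 2`, AS PRINTED**: `(∀ X > 2, ∫₂^X E_i > 0) ⟹ RH` — the `←`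
directions of both clauses of the named fact `Zhao2025MertensMean_thm1`, as theorems
(`Zhao2025.riemannHypothesis_of_integral_E₁_pos`, g5; `Zhao2025.riemannHypothesis_of_integral_E₂_pos`, this file).
RH-EQUIVALENT criterion, necessity half; nothing here bears on the truth of RH. [cite: Zhao2025MertensMean, Thm 1, (b) ⟹ (a)] -/
theorem Zhao2025MertensMean_thm1_necessity :
    ((∀ X : ℝ, 2 < X → 0 < ∫ x in (2 : ℝ)..X, Zhao2025.E₁ x) → RiemannHypothesis) ∧
    ((∀ X : ℝ, 2 < X → 0 < ∫ x in (2 : ℝ)..X, Zhao2025.E₂ x) → RiemannHypothesis) :=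
  ⟨Zhao2025.riemannHypothesis_of_integral_E₁_pos, Zhao2025.riemannHypothesis_of_integral_E₂_pos⟩

/-- **Zhao 2025, Theorem 1 in the "sufficiently large `X`" reading, both clauses PROVED**:
`RH ⟺ ∃ X₀, ∀ X > X₀, ∫₂^X E_i > 0` for `i = 1` (`Zhao2025.riemannHypothesis_iff_eventually_integral_E₁_pos`) and `i = 2`
(`Zhao2025.riemannHypothesis_iff_eventually_integral_E₂_pos`). The printed clauses have `X > 2`; the finite ranges
`2 < X ≤ X₀` rest on the source's numerical inputs and are not formalized. RH-EQUIVALENT criterion; nothing here bears on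
the truth of RH. [cite: Zhao2025MertensMean, Thm 1] -/
theorem Zhao2025MertensMean_thm1_eventual :
    (RiemannHypothesis ↔ ∃ X₀ : ℝ, ∀ X : ℝ, X₀ < X → 0 < ∫ x in (2 : ℝ)..X, Zhao2025.E₁ x) ∧
    (RiemannHypothesis ↔ ∃ X₀ : ℝ, ∀ X : ℝ, X₀ < X → 0 < ∫ x in (2 : ℝ)..X, Zhao2025.E₂ x) :=
  ⟨Zhao2025.riemannHypothesis_iff_eventually_integral_E₁_pos, Zhao2025.riemannHypothesis_iff_eventually_integral_E₂_pos⟩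

end Literature.NumberTheory.LFunctions
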